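import Summits.ABC.ABC.Theorems.TwistAmplificationSharpModerateLawCuspDispersionDefs

/-!
# Crux `TwistAmplification.SharpModerateLaw` (stmt-ABC-1975), line `deep-moduli-cusp-dispersion`:
the Hall-regime law counts Hall near-misses with square-root strength (calibration of `stub_hallRegime`)

The line cuts the cusp counting law C⁺′ (`CuspLawD`: pairs `(c₄, c₆)` with `c₄c₆ ≠ 0`, `c₄³ ≠ c₆²`,
`1728 ∣ c₄³ − c₆²`, tower-free `TF`, dyadic level `max(|c₄|³, |c₄³ − c₆²|/1728) ∈ (Y/2, Y]`, full
conductor proxy `Nstar ≤ X`, in the cone `X³ ≤ 8Y ≤ 8X^σ`) into three regimes; the open stub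
`stub_hallRegime` is the law on the HALL regime `|c₄³ − c₆²| ≤ 1728·Y^{1/2}` (`LawOn HallRegime`).
This file certifies what that stub asserts about the classical Hall problem: `LawOn HallRegime` implies
that the Hall near-misses `{(u, v) : 0 < u ≤ U, u squarefree, (u, 6) = 1, u³ ≠ v², 2|u³ − v²| ≤ √u}`
number `≤ C_ε · U^{1/2 + ε}` (registered calibration sub-goal `nearCuspSqrtCount_of_hallRegimeLaw` of
stmt-ABC-1975).  Trivially the count is `≪ U`, van der Corput / exponent pairs give `U^{3/4…0.73}`,
conjecturally it is `O(log U)` (Hall, Danilov): the stub sits at square-root cancellation for `u^{3/2}`.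

Proof.  SCALING: `q = (u, v) ↦ x = (72²u, 72³v) = (5184u, 373248v)` (injective) has
`x.1³ − x.2² = 72⁶(u³ − v²)`, `72⁶ = 1728 · 80621568`; `x` is tower-free because `u` is squarefree and
prime to `6` (`v₂(x.1) = 6 < 8`, `v₃(x.1) = 4 < 5`, `p⁴ ∤ 5184u` for `p ≥ 5`: `tf_scale`), and
`Nstar x ≤ (rad(6|u³ − v²|))² ≤ 36|u³ − v²|² ≤ 9u` (`nstar_scale_le`, using `4|u³−v²|² ≤ u`).  CELLS: for a
scale `V ≥ 108` and `u ≤ V < 2^{1/3}u`, the point `x` lies in the Hall set at `X = 9V`, `Y = 72⁶V³`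
(`scale_mem_hallSet`: level `72⁶u³ ∈ (Y/2, Y]`, tube, `Nstar ≤ 9u ≤ X`, Hall `216|u³−v²| ≤ 108√V ≤ V√V`),
the cone holds (`cone_scale`, `σ = 13`) and the law's right side at exponent `ε/2` is `≤ 10·V^{1/2+ε}`
(`bound_scale`).  SUM: `#F(U) ≤ #F(U/2^{1/3}) + #cell(U)` and induction over the scales `2^{n/3}`
with the geometric weight `2^{θ/3} > 1`, `θ = 1/2 + ε`, give `#F(U) ≤ A·U^θ + #F(107)`
(`nearCuspSqrtCount_of_hallRegimeLaw`).
-/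

noncomputable section

namespace Summit.ABC.ABC.Theorems.SharpModerateLaw.CuspDispersion

/-! ## 1. The scaled pair `(72²u, 72³v)`: tower-freeness and conductor proxy -/

/-- An integer prime to `6` has no common divisor with `6` other than units. -/
private lemma dvd_one_of_isCoprime_six {u d : ℤ} (hcop : IsCoprime u 6) (hd : d ∣ 6) (h : d ∣ u) :
    d ∣ 1 := by
  obtain ⟨a, b, hab⟩ := hcop
  rw [← hab]
  exact dvd_add (dvd_mul_of_dvd_right h a) (dvd_mul_of_dvd_right hd b)

/-- **Tower-freeness of the scaled pair.** For `u` squarefree and prime to `6`, `(5184u, 373248v)` is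
tower-free: `2⁸ ∤ 2⁶·81u`, `3⁵ ∤ 3⁴·64u`, and `p⁴ ∤ 5184u` for a prime `p ≥ 5` (else `p² ∣ u`). -/
theorem tf_scale {u : ℤ} (v : ℤ) (hsq : Squarefree u) (hcop : IsCoprime u 6) :
    TF (5184 * u, 373248 * v) := by
  have h2 : ¬ (2 : ℤ) ∣ u := fun h => by
    have h1 := dvd_one_of_isCoprime_six hcop ⟨3, by norm_num⟩ h; norm_num at h1
  have h3 : ¬ (3 : ℤ) ∣ u := fun h => by
    have h1 := dvd_one_of_isCoprime_six hcop ⟨2, by norm_num⟩ h; norm_num at h1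
  refine ⟨fun p hp hp5 h => ?_, fun h => ?_, fun h => ?_⟩
  · obtain ⟨h4, -⟩ := h
    simp only at h4
    have hpZ : Prime (p : ℤ) := Nat.prime_iff_prime_int.mp hp
    have hndvd : ¬ (p : ℤ) ∣ 5184 := fun hd => by
      have h64 : p ∣ 2 ^ 6 * 3 ^ 4 := by norm_num; exact_mod_cast hd
      rcases (Nat.Prime.dvd_mul hp).mp h64 with h | h
      · have := Nat.le_of_dvd two_pos (hp.dvd_of_dvd_pow h); omega
      · have := Nat.le_of_dvd (by norm_num) (hp.dvd_of_dvd_pow h); omega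
    have hu4 : (p : ℤ) ^ 4 ∣ u := hpZ.pow_dvd_of_dvd_mul_left 4 hndvd h4
    have hunit := hsq (p : ℤ) (dvd_trans ⟨(p : ℤ) ^ 2, by ring⟩ hu4)
    rw [Int.isUnit_iff] at hunit
    omega
  · obtain ⟨h8, -⟩ := h
    simp only at h8; norm_num at h8; omega
  · obtain ⟨h5, -⟩ := h
    simp only at h5; norm_num at h5; omega

/-- **Conductor proxy of the scaled pair.** `Δ = 72⁶(u³ − v²)/1728 = 2¹²3⁹(u³ − v²)`, so the primes of
`Δ` are those of `6|u³ − v²|`, each charged at most `p²`: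
`Nstar ≤ (∏_{p ∣ 6|u³−v²|} p)² ≤ (6|u³ − v²|)²`. -/
theorem nstar_scale_le {u : ℤ} (v : ℤ) (hD : u ^ 3 - v ^ 2 ≠ 0) :
    Nstar (5184 * u, 373248 * v) ≤ 36 * (u ^ 3 - v ^ 2).natAbs ^ 2 := by
  unfold Nstar
  simp only
  have e : ((5184 * u) ^ 3 - (373248 * v) ^ 2) / 1728 = 80621568 * (u ^ 3 - v ^ 2) := by
    rw [show (5184 * u) ^ 3 - (373248 * v) ^ 2 = 1728 * (80621568 * (u ^ 3 - v ^ 2)) by ring]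
    exact Int.mul_ediv_cancel_left _ (by norm_num)
  rw [e, Int.natAbs_mul]
  set d : ℕ := (u ^ 3 - v ^ 2).natAbs with hd
  have hd0 : d ≠ 0 := Int.natAbs_ne_zero.mpr hD
  have h806 : (80621568 : ℤ).natAbs = 80621568 := rfl
  rw [h806]
  have h6d : 6 * d ≠ 0 := Nat.mul_ne_zero (by norm_num) hd0
  have hsub : (80621568 * d).primeFactors ⊆ (6 * d).primeFactors := by
    have h1 : 80621568 * d ∣ (6 * d) ^ 12 := by
      rw [mul_pow]
      exact mul_dvd_mul ⟨27, by norm_num⟩ (dvd_pow_self d (by norm_num))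
    calc (80621568 * d).primeFactors ⊆ ((6 * d) ^ 12).primeFactors :=
          Nat.primeFactors_mono h1 (pow_ne_zero _ h6d)
      _ = (6 * d).primeFactors := Nat.primeFactors_pow _ (by norm_num)
  calc ∏ p ∈ (80621568 * d).primeFactors, (if (p : ℤ) ∣ 5184 * u then p ^ 2 else p)
      ≤ ∏ p ∈ (80621568 * d).primeFactors, p ^ 2 := by
        refine Finset.prod_le_prod' fun p hp => ?_
        have h1 := (Nat.prime_of_mem_primeFactors hp).one_lt
        split_ifs
        · exact le_rfl
        · nlinarith
    _ ≤ ∏ p ∈ (6 * d).primeFactors, p ^ 2 := by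
        refine Finset.prod_le_prod_of_subset_of_one_le' hsub fun p hp _ => ?_
        exact Nat.one_le_pow _ _ (Nat.prime_of_mem_primeFactors hp).pos
    _ = (∏ p ∈ (6 * d).primeFactors, p) ^ 2 := Finset.prod_pow _ 2 (fun p => p)
    _ ≤ (6 * d) ^ 2 :=
        Nat.pow_le_pow_left (Nat.le_of_dvd (Nat.pos_of_ne_zero h6d) (Nat.prod_primeFactors_dvd _)) 2
    _ = 36 * d ^ 2 := by ring

/-! ## 2. The scaled pair lies in the Hall set of the cell -/

/-- **Membership.** For `u > 0` squarefree and prime to `6`, `u³ ≠ v²`, `2|u³ − v²| ≤ √u`, and a scale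
`V ≥ 108` with `u ≤ V`, `V³ < 2u³`, the scaled pair `(5184u, 373248v)` lies in the Hall set at
`X = 9V`, `Y = 72⁶V³ = 139314069504·V³`: `c₄c₆ ≠ 0` (`v = 0` would give `2u³ ≤ √u`), `Δ ≠ 0`,
`1728 ∣ 72⁶(u³−v²)`, tower-free (`tf_scale`), level `|c₄|³ = 72⁶u³ ∈ (Y/2, Y]`, tube
`72⁶|u³−v²| ≤ 72⁶u ≤ 1728Y`, `Nstar ≤ 36|u³−v²|² ≤ 9u ≤ X` (`nstar_scale_le`), and the Hall
condition `72⁶|u³−v²| ≤ 1728·72³·V√V`, i.e. `216|u³−v²| ≤ V√V`, from `2|u³−v²| ≤ √u ≤ √V`, `108 ≤ V`. -/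
theorem scale_mem_hallSet {u v : ℤ} {V : ℝ} (hu : 0 < u) (hsq : Squarefree u) (hcop : IsCoprime u 6)
    (hne : u ^ 3 ≠ v ^ 2) (hhall : (2 * |u ^ 3 - v ^ 2| : ℝ) ≤ Real.sqrt u)
    (hV : 108 ≤ V) (huV : (u : ℝ) ≤ V) (hVu : V ^ 3 < 2 * (u : ℝ) ^ 3) :
    ((5184 * u, 373248 * v) : ℤ × ℤ) ∈ {x : ℤ × ℤ | x ∈ cuspSetD (9 * V) (139314069504 * V ^ 3) ∧
      HallRegime (139314069504 * V ^ 3) x} := by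
  simp only [Set.mem_setOf_eq, cuspSetD, HallRegime]
  have hu1 : (1 : ℝ) ≤ u := by exact_mod_cast hu
  have hu0 : (0 : ℝ) ≤ u := by linarith
  have hV0 : (0 : ℝ) ≤ V := by linarith
  have hV1 : (1 : ℝ) ≤ V := by linarith
  have hsqrt_u : Real.sqrt (u : ℝ) ≤ u := by rw [Real.sqrt_le_left hu0]; nlinarith
  have hu3 : (u : ℝ) ≤ (u : ℝ) ^ 3 := le_self_pow₀ hu1 (by norm_num)
  have hhall' : 2 * |(u : ℝ) ^ 3 - (v : ℝ) ^ 2| ≤ Real.sqrt u := by exact_mod_cast hhall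
  have ha0 : 0 ≤ |(u : ℝ) ^ 3 - (v : ℝ) ^ 2| := abs_nonneg _
  have haV : 2 * |(u : ℝ) ^ 3 - (v : ℝ) ^ 2| ≤ Real.sqrt V := hhall'.trans (Real.sqrt_le_sqrt huV)
  have hau : |(u : ℝ) ^ 3 - (v : ℝ) ^ 2| ≤ u := by linarith
  have ha2 : 4 * |(u : ℝ) ^ 3 - (v : ℝ) ^ 2| ^ 2 ≤ u := by
    nlinarith [(Real.le_sqrt (by linarith) hu0).mp hhall']
  have hv0 : v ≠ 0 := by
    rintro rfl
    have h : 2 * |(u : ℝ) ^ 3 - ((0 : ℤ) : ℝ) ^ 2| = 2 * (u : ℝ) ^ 3 := by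
      rw [Int.cast_zero, show (u : ℝ) ^ 3 - (0 : ℝ) ^ 2 = (u : ℝ) ^ 3 by ring,
        abs_of_nonneg (by positivity)]
    rw [h] at hhall'
    nlinarith
  have hD0 : u ^ 3 - v ^ 2 ≠ 0 := sub_ne_zero.mpr hne
  have e1 : (5184 * u) ^ 3 - (373248 * v) ^ 2 = 139314069504 * (u ^ 3 - v ^ 2) := by ring
  have e2 : |5184 * u| ^ 3 = 139314069504 * u ^ 3 := by
    rw [abs_of_pos (by positivity : (0 : ℤ) < 5184 * u)]; ring
  have e3 : |(5184 * u) ^ 3 - (373248 * v) ^ 2| = 139314069504 * |u ^ 3 - v ^ 2| := by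
    rw [e1, abs_mul, abs_of_pos (by norm_num : (0 : ℤ) < 139314069504)]
  have c2 : (((|5184 * u| ^ 3 : ℤ)) : ℝ) = 139314069504 * (u : ℝ) ^ 3 := by rw [e2]; push_cast; ring
  have c3 : (((|(5184 * u) ^ 3 - (373248 * v) ^ 2| : ℤ)) : ℝ) =
      139314069504 * |(u : ℝ) ^ 3 - (v : ℝ) ^ 2| := by
    rw [e3]; push_cast; ring
  refine ⟨⟨?_, ?_, ?_, ⟨80621568 * (u ^ 3 - v ^ 2), by ring⟩, tf_scale v hsq hcop, ?_, ?_, ?_, ?_⟩, ?_⟩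
  · exact (by positivity : (0 : ℤ) < 5184 * u).ne'
  · exact mul_ne_zero (by norm_num) hv0
  · intro h
    apply hD0
    have h0 : (139314069504 : ℤ) * (u ^ 3 - v ^ 2) = 0 := by rw [← e1, h, sub_self]
    simpa using h0
  · -- level `|c₄|³ ≤ Y`
    rw [c2]; nlinarith [pow_le_pow_left₀ hu0 huV 3]
  · -- tube `|c₄³ − c₆²| ≤ 1728Y`
    rw [c3]; nlinarith [(le_self_pow₀ hV1 three_ne_zero : V ≤ V ^ 3)]
  · -- dyadic floor `Y < 2|c₄|³`
    rw [c2]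
    have h : (139314069504 : ℝ) * V ^ 3 < 2 * (139314069504 * (u : ℝ) ^ 3) := by linarith
    exact lt_of_lt_of_le h (mul_le_mul_of_nonneg_left (le_max_left _ _) (by norm_num))
  · -- conductor proxy `Nstar ≤ 36|u³ − v²|² ≤ 9u ≤ 9V`
    have h' : ((Nstar (5184 * u, 373248 * v) : ℕ) : ℝ) ≤ 36 * |(u : ℝ) ^ 3 - (v : ℝ) ^ 2| ^ 2 := by
      have h1 := (Nat.cast_le (α := ℝ)).mpr (nstar_scale_le v hD0)
      push_cast [Nat.cast_natAbs] at h1; exact h1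
    linarith
  · -- Hall condition `72⁶|u³ − v²| ≤ 1728·Y^{1/2}`, `Y^{1/2} = 72³·V·√V`
    rw [c3]
    have hY : (139314069504 : ℝ) * V ^ 3 = (373248 * V * Real.sqrt V) ^ 2 := by
      rw [mul_pow, mul_pow, Real.sq_sqrt hV0]; ring
    rw [← Real.sqrt_eq_rpow, hY, Real.sqrt_sq (by positivity)]
    have hsV : 0 ≤ Real.sqrt V := Real.sqrt_nonneg V
    have h1 : 108 * Real.sqrt V ≤ V * Real.sqrt V := mul_le_mul_of_nonneg_right hV hsV
    nlinarith [h1, haV]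

/-! ## 3. The cell scales: cone and size of the law's right side -/

/-- The cell scales `X = 9V`, `Y = 72⁶V³` (`V ≥ 1`) lie in the cone of the law with `σ = 13`:
`X, Y ≥ 1`, `X³ = 729V³ ≤ 8Y`, `Y ≤ 9¹³V¹³ = X¹³`. -/
theorem cone_scale {V : ℝ} (hV : 1 ≤ V) :
    1 ≤ 9 * V ∧ 1 ≤ 139314069504 * V ^ 3 ∧ (9 * V) ^ 3 ≤ 8 * (139314069504 * V ^ 3) ∧
      139314069504 * V ^ 3 ≤ (9 * V) ^ (13 : ℝ) := by
  have hV3 : 1 ≤ V ^ 3 := one_le_pow₀ hV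
  refine ⟨by linarith, by linarith, by nlinarith, ?_⟩
  rw [show (13 : ℝ) = ((13 : ℕ) : ℝ) by norm_num, Real.rpow_natCast]
  have h1 : V ^ 3 ≤ V ^ 13 := pow_le_pow_right₀ hV (by norm_num)
  have h2 : (9 * V) ^ 13 = 2541865828329 * V ^ 13 := by ring
  rw [h2]
  nlinarith

/-- At the cell scales the law's right side (exponent `ε/2`) is `≤ 10·V^{1/2+ε}` for `V ≥ 9`:
`(9V)^{ε/2} ≤ (V²)^{ε/2} = V^ε`, `Y^{-1/6} ≤ (V³)^{-1/6} = V^{-1/2}`, `X·V^{-1/2} = 9V^{1/2}`, `1 ≤ V^{1/2}`. -/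
theorem bound_scale {V ε : ℝ} (hV : 9 ≤ V) (hε : 0 < ε) :
    (9 * V) ^ (ε / 2) * (9 * V * (139314069504 * V ^ 3) ^ (-(1 / 6 : ℝ)) + 1) ≤
      10 * V ^ (1 / 2 + ε) := by
  have hV1 : 1 ≤ V := by linarith
  have hV0 : 0 < V := by linarith
  have h1 : (9 * V) ^ (ε / 2) ≤ V ^ ε := by
    have h9 : 9 * V ≤ V ^ 2 := by nlinarith
    calc (9 * V) ^ (ε / 2) ≤ (V ^ 2) ^ (ε / 2) := Real.rpow_le_rpow (by linarith) h9 (by linarith)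
      _ = V ^ ε := by
          rw [← Real.rpow_natCast V 2, ← Real.rpow_mul hV0.le]
          congr 1; push_cast; ring
  have h2 : (139314069504 * V ^ 3) ^ (-(1 / 6 : ℝ)) ≤ V ^ (-(1 / 2 : ℝ)) := by
    have hle : V ^ 3 ≤ 139314069504 * V ^ 3 := by nlinarith [pow_pos hV0 3]
    calc (139314069504 * V ^ 3) ^ (-(1 / 6 : ℝ)) ≤ (V ^ 3) ^ (-(1 / 6 : ℝ)) :=
          Real.rpow_le_rpow_of_nonpos (pow_pos hV0 3) hle (by norm_num)
      _ = V ^ (-(1 / 2 : ℝ)) := by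
          rw [← Real.rpow_natCast V 3, ← Real.rpow_mul hV0.le]
          congr 1; push_cast; ring
  have h3 : V * V ^ (-(1 / 2 : ℝ)) = V ^ (1 / 2 : ℝ) := by
    have h := Real.rpow_add hV0 1 (-(1 / 2 : ℝ))
    rw [Real.rpow_one] at h
    rw [← h]
    congr 1; ring
  have h4 : 1 ≤ V ^ (1 / 2 : ℝ) := Real.one_le_rpow hV1 (by norm_num)
  have h5 : V ^ ε * V ^ (1 / 2 : ℝ) = V ^ (1 / 2 + ε) := by
    rw [← Real.rpow_add hV0]; congr 1; ring
  have hA : 9 * V * (139314069504 * V ^ 3) ^ (-(1 / 6 : ℝ)) ≤ 9 * V ^ (1 / 2 : ℝ) := by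
    calc 9 * V * (139314069504 * V ^ 3) ^ (-(1 / 6 : ℝ)) ≤ 9 * V * V ^ (-(1 / 2 : ℝ)) :=
          mul_le_mul_of_nonneg_left h2 (by linarith)
      _ = 9 * V ^ (1 / 2 : ℝ) := by rw [mul_assoc, h3]
  have hpos : 0 ≤ 9 * V * (139314069504 * V ^ 3) ^ (-(1 / 6 : ℝ)) + 1 := by positivity
  calc (9 * V) ^ (ε / 2) * (9 * V * (139314069504 * V ^ 3) ^ (-(1 / 6 : ℝ)) + 1)
      ≤ V ^ ε * (9 * V ^ (1 / 2 : ℝ) + V ^ (1 / 2 : ℝ)) :=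
        mul_le_mul h1 (by linarith) hpos (Real.rpow_nonneg hV0.le _)
    _ = 10 * (V ^ ε * V ^ (1 / 2 : ℝ)) := by ring
    _ = 10 * V ^ (1 / 2 + ε) := by rw [h5]

/-! ## 4. Finiteness of the family and the calibration theorem -/

/-- The family up to `U` is finite: `1 ≤ u ≤ ⌈U⌉` and `v² ≤ u³ + |u³ − v²| ≤ u³ + u` (as `2|u³−v²| ≤ √u ≤ u`). -/
theorem fam_finite (U : ℝ) :
    {q : ℤ × ℤ | 0 < q.1 ∧ (q.1 : ℝ) ≤ U ∧ Squarefree q.1 ∧ IsCoprime q.1 6 ∧ q.1 ^ 3 ≠ q.2 ^ 2 ∧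
      (2 * |q.1 ^ 3 - q.2 ^ 2| : ℝ) ≤ Real.sqrt q.1}.Finite := by
  set N : ℕ := ⌈U⌉₊ with hN
  refine ((Set.finite_Icc (1 : ℤ) N).prod
    (Set.finite_Icc (-((N : ℤ) ^ 3 + N)) ((N : ℤ) ^ 3 + N))).subset ?_
  rintro q ⟨hu, huU, -, -, -, hh⟩
  simp only [Set.mem_prod, Set.mem_Icc]
  have huN : q.1 ≤ (N : ℤ) := by
    have h : (q.1 : ℝ) ≤ (N : ℝ) := huU.trans (Nat.le_ceil U)
    exact_mod_cast h
  have hu1 : (1 : ℝ) ≤ q.1 := by exact_mod_cast hu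
  have hsqrt : Real.sqrt (q.1 : ℝ) ≤ q.1 := by
    rw [Real.sqrt_le_left (by linarith)]; nlinarith
  have hD : ((|q.1 ^ 3 - q.2 ^ 2| : ℤ) : ℝ) ≤ q.1 := by
    have h0 : (0 : ℝ) ≤ ((|q.1 ^ 3 - q.2 ^ 2| : ℤ) : ℝ) := by exact_mod_cast abs_nonneg _
    linarith
  have hD' : |q.1 ^ 3 - q.2 ^ 2| ≤ q.1 := by exact_mod_cast hD
  have hv2 : q.2 ^ 2 ≤ (N : ℤ) ^ 3 + N := by
    have h1 := (abs_le.mp hD').1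
    have h2 : q.1 ^ 3 ≤ (N : ℤ) ^ 3 := pow_le_pow_left₀ (by linarith) huN 3
    linarith
  have hv : |q.2| ≤ (N : ℤ) ^ 3 + N := by
    have h := Int.natAbs_le_self_sq q.2
    rw [Int.natCast_natAbs] at h
    exact h.trans hv2
  exact ⟨⟨by linarith, huN⟩, abs_le.mp hv⟩

/-- **Calibration of `stub_hallRegime`: the Hall-regime law implies a square-root-strength count of
Hall near-misses.**  If C⁺′ holds on the Hall regime (`LawOn HallRegime`, the statement of the line's
open stub `stub_hallRegime`), then for every `ε > 0` there is `C` with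
`#{(u, v) ∈ ℤ² : 0 < u ≤ U, u squarefree, (u, 6) = 1, u³ ≠ v², 2|u³ − v²| ≤ √u} ≤ C·U^{1/2+ε}`
for all `U ≥ 1`.  Proof: the law at `σ = 13`, exponent `ε/2`; a cell `U/2^{1/3} < u ≤ U` (`U ≥ 108`)
injects by `(u,v) ↦ (72²u, 72³v)` into the Hall set at `(9U, 72⁶U³)` (`scale_mem_hallSet`), of size
`≤ 10·max(C₀,0)·U^{1/2+ε}` (`cone_scale`, `bound_scale`); scales `U < 108` are inside the finite set
`F(107)`; induction over `U ≤ 2^{n/3}` with `A = cρ/(ρ−1)`, `ρ = 2^{(1/2+ε)/3}`. -/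
theorem nearCuspSqrtCount_of_hallRegimeLaw :
    LawOn HallRegime → ∀ ε : ℝ, 0 < ε → ∃ C : ℝ, ∀ U : ℝ, 1 ≤ U → (Set.ncard {q : ℤ × ℤ | 0 < q.1 ∧ (q.1 : ℝ) ≤ U ∧ Squarefree q.1 ∧ IsCoprime q.1 6 ∧ q.1 ^ 3 ≠ q.2 ^ 2 ∧ (2 * |q.1 ^ 3 - q.2 ^ 2| : ℝ) ≤ Real.sqrt q.1} : ℝ) ≤ C * U ^ (1 / 2 + ε) := by
  intro hlaw ε hε
  set F : ℝ → Set (ℤ × ℤ) := fun U : ℝ => {q : ℤ × ℤ | 0 < q.1 ∧ (q.1 : ℝ) ≤ U ∧ Squarefree q.1 ∧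
    IsCoprime q.1 6 ∧ q.1 ^ 3 ≠ q.2 ^ 2 ∧ (2 * |q.1 ^ 3 - q.2 ^ 2| : ℝ) ≤ Real.sqrt q.1} with hF
  show ∃ C : ℝ, ∀ U : ℝ, 1 ≤ U → (Set.ncard (F U) : ℝ) ≤ C * U ^ (1 / 2 + ε)
  have hfin : ∀ U : ℝ, (F U).Finite := fun U => fam_finite U
  obtain ⟨C₀, hC₀⟩ := hlaw 13 (by norm_num) (ε / 2) (by positivity)
  -- constants
  set C : ℝ := max C₀ 0 with hC
  have hC0 : 0 ≤ C := le_max_right _ _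
  have hCC : C₀ ≤ C := le_max_left _ _
  set θ : ℝ := 1 / 2 + ε with hθ
  have hθpos : 0 < θ := by rw [hθ]; positivity
  set b : ℝ := (2 : ℝ) ^ (1 / 3 : ℝ) with hb
  have hb1 : 1 < b := Real.one_lt_rpow one_lt_two (by norm_num)
  have hb0 : 0 < b := by linarith
  have hb2 : b ≤ 2 := by
    have h := Real.rpow_le_rpow_of_exponent_le one_le_two (show (1 / 3 : ℝ) ≤ 1 by norm_num)
    rw [Real.rpow_one] at h
    rw [hb]; exact h
  have hb3 : b ^ 3 = 2 := by
    rw [hb, ← Real.rpow_mul_natCast zero_le_two]; norm_num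
  set ρ : ℝ := b ^ θ with hρ
  have hρ1 : 1 < ρ := Real.one_lt_rpow hb1 hθpos
  set c : ℝ := 10 * C with hc
  set A : ℝ := c * ρ / (ρ - 1) with hA
  have hA0 : 0 ≤ A := div_nonneg (by positivity) (by linarith)
  have halg : A / ρ + c = A := by
    have hρ' : ρ - 1 ≠ 0 := by linarith
    have hρ0 : ρ ≠ 0 := by linarith
    rw [hA]; field_simp; ring
  set B : ℝ := (Set.ncard (F 107) : ℝ) with hB
  have hB0 : 0 ≤ B := Nat.cast_nonneg _
  -- (i) small scales sit inside `F(107)`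
  have hsmall : ∀ U : ℝ, U < 108 → (Set.ncard (F U) : ℝ) ≤ B := by
    intro U hU
    have hsub : F U ⊆ F 107 := by
      rintro q ⟨hu, huU, hrest⟩
      refine ⟨hu, ?_, hrest⟩
      have h1 : (q.1 : ℝ) < 108 := lt_of_le_of_lt huU hU
      have h2 : q.1 < 108 := by exact_mod_cast h1
      have h3 : q.1 ≤ 107 := by omega
      exact_mod_cast h3
    rw [hB]; exact_mod_cast Set.ncard_le_ncard hsub (hfin 107)
  -- (ii) one cell `U/b < u ≤ U`, `U ≥ 108`, via the law at `(9U, 72⁶U³)`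
  have hcell : ∀ U : ℝ, 108 ≤ U →
      (Set.ncard {q : ℤ × ℤ | q ∈ F U ∧ U / b < (q.1 : ℝ)} : ℝ) ≤ c * U ^ θ := by
    intro U hU
    have hU1 : 1 ≤ U := by linarith
    obtain ⟨hX1, hY1, hcone1, hcone2⟩ := cone_scale hU1
    have h1 : Set.ncard {q : ℤ × ℤ | q ∈ F U ∧ U / b < (q.1 : ℝ)} ≤
        Set.ncard {x : ℤ × ℤ | x ∈ cuspSetD (9 * U) (139314069504 * U ^ 3) ∧
          HallRegime (139314069504 * U ^ 3) x} := by
      refine Set.ncard_le_ncard_of_injOn (fun q : ℤ × ℤ => ((5184 * q.1, 373248 * q.2) : ℤ × ℤ))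
        ?_ ?_ (sepSet_finite HallRegime _ _ hY1)
      · rintro ⟨u, v⟩ ⟨⟨hu, huU, hsq, hcop, hne, hh⟩, hlow⟩
        have hlow' : U < (u : ℝ) * b := (div_lt_iff₀ hb0).mp hlow
        have hcube : U ^ 3 < 2 * (u : ℝ) ^ 3 := by
          have h := pow_lt_pow_left₀ hlow' (by linarith) (three_ne_zero)
          rw [mul_pow, hb3] at h
          linarith
        exact scale_mem_hallSet hu hsq hcop hne hh hU huU hcube
      · rintro ⟨u, v⟩ - ⟨u', v'⟩ - h
        simp only [Prod.mk.injEq] at h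
        obtain ⟨h1, h2⟩ := h
        simp only [Prod.mk.injEq]
        constructor <;> omega
    have hbound := bound_scale (show (9 : ℝ) ≤ U by linarith) hε
    have hnn := bound_nonneg (ε := ε / 2) hX1 hY1
    calc (Set.ncard {q : ℤ × ℤ | q ∈ F U ∧ U / b < (q.1 : ℝ)} : ℝ)
        ≤ (Set.ncard {x : ℤ × ℤ | x ∈ cuspSetD (9 * U) (139314069504 * U ^ 3) ∧
            HallRegime (139314069504 * U ^ 3) x} : ℝ) := by exact_mod_cast h1
      _ ≤ C₀ * (9 * U) ^ (ε / 2) * (9 * U * (139314069504 * U ^ 3) ^ (-(1 / 6 : ℝ)) + 1) :=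
          hC₀ _ _ hX1 hY1 hcone1 hcone2
      _ ≤ C * (9 * U) ^ (ε / 2) * (9 * U * (139314069504 * U ^ 3) ^ (-(1 / 6 : ℝ)) + 1) := by
          have h := mul_le_mul_of_nonneg_right hCC hnn
          simpa only [mul_assoc] using h
      _ ≤ C * (10 * U ^ θ) := by rw [mul_assoc]; exact mul_le_mul_of_nonneg_left hbound hC0
      _ = c * U ^ θ := by rw [hc]; ring
  -- (iii) induction over the scales `U ≤ b^n`
  have key : ∀ n : ℕ, ∀ U : ℝ, 1 ≤ U → U ≤ b ^ n → (Set.ncard (F U) : ℝ) ≤ A * U ^ θ + B := by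
    intro n
    induction n with
    | zero =>
      intro U hU1 hUn
      have hAU : 0 ≤ A * U ^ θ := mul_nonneg hA0 (Real.rpow_nonneg (by linarith) _)
      rw [pow_zero] at hUn
      have h := hsmall U (by linarith)
      linarith
    | succ n ih =>
      intro U hU1 hUn
      have hAU : 0 ≤ A * U ^ θ := mul_nonneg hA0 (Real.rpow_nonneg (by linarith) _)
      rcases lt_or_ge U 108 with hlt | hge
      · have h := hsmall U hlt
        linarith
      · have hU0 : 0 ≤ U := by linarith
        have hUb1 : 1 ≤ U / b := by rw [le_div_iff₀ hb0]; linarith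
        have hUbn : U / b ≤ b ^ n := by rw [div_le_iff₀ hb0, ← pow_succ]; exact hUn
        have hsplit : F U ⊆ F (U / b) ∪ {q : ℤ × ℤ | q ∈ F U ∧ U / b < (q.1 : ℝ)} := by
          intro q hq
          rcases le_or_gt (q.1 : ℝ) (U / b) with h | h
          · exact Or.inl ⟨hq.1, h, hq.2.2⟩
          · exact Or.inr ⟨hq, h⟩
        have hfin' : (F (U / b) ∪ {q : ℤ × ℤ | q ∈ F U ∧ U / b < (q.1 : ℝ)}).Finite :=
          (hfin _).union ((hfin U).subset fun q hq => hq.1)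
        have h1 := Set.ncard_le_ncard hsplit hfin'
        have h2 := Set.ncard_union_le (F (U / b)) {q : ℤ × ℤ | q ∈ F U ∧ U / b < (q.1 : ℝ)}
        have h3 : (Set.ncard (F U) : ℝ) ≤ (Set.ncard (F (U / b)) : ℝ) +
            (Set.ncard {q : ℤ × ℤ | q ∈ F U ∧ U / b < (q.1 : ℝ)} : ℝ) := by
          exact_mod_cast h1.trans h2
        have hdiv : (U / b) ^ θ = U ^ θ / ρ := by rw [hρ, Real.div_rpow hU0 hb0.le]
        calc (Set.ncard (F U) : ℝ) ≤ (A * (U / b) ^ θ + B) + c * U ^ θ := by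
              linarith [ih (U / b) hUb1 hUbn, hcell U hge]
          _ = (A / ρ + c) * U ^ θ + B := by rw [hdiv]; ring
          _ = A * U ^ θ + B := by rw [halg]
  -- (iv) conclusion
  refine ⟨A + B, fun U hU => ?_⟩
  obtain ⟨n, hn⟩ := pow_unbounded_of_one_lt U hb1
  have h1 := key n U hU hn.le
  have h2 : 1 ≤ U ^ θ := Real.one_le_rpow hU hθpos.le
  calc (Set.ncard (F U) : ℝ) ≤ A * U ^ θ + B := h1
    _ ≤ A * U ^ θ + B * U ^ θ := by nlinarith
    _ = (A + B) * U ^ θ := by ring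

end Summit.ABC.ABC.Theorems.SharpModerateLaw.CuspDispersion

end
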